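import Summits.CriticalPhenomena.PercolationContinuityZ3.Theorems.PercNearOneGluingNoHeavyLowerTailSahiE3BlockLayers
import Summits.CriticalPhenomena.PercolationContinuityZ3.Theorems.PercNearOneGluingNoHeavyLowerTailSahiE3BlockPair
import Mathlib.Tactic.Linarith
import Mathlib.Tactic.Ring
import Mathlib.Tactic.Positivity
import HarnessLib
import HarnessLib.Audit

/-!
# `NoHeavyLowerTail` (crux stmt-CriticalPhenomena-4575), Sahi programme P4: **the principal block OR-step** `(x_B = ⊤) ∨ G`
# (block OR-step, file 5 — the flow certificate)

Support file (cell `prim-l12`, seat P4, generation 15; `--supports stmt-CriticalPhenomena-4575`).  No named facts, no sorries;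
standard axioms; def-free.

THEOREM `cert_block_or_step`.  Let `B` be ANY finite poset with a top element `t` and weights `w ≥ 0` satisfying Harris' inequality
for up-sets (e.g. `Bool^b` with product weights, any finite distributive lattice with log-supermodular weights), and let
`(Q, ν', G, R', Fl')` be an exactly certified slot (hypotheses of `…SahiE3LroOrStep.cert_or_step`: `ν' ≥ 0` Harris, `G` an up-set,
flow certificate with exact deliveries).  Then the slot `U = {(b,s) | b = t ∨ s ∈ G}` ("`(x_B = ⊤) ∨ G`", for `B = Bool^b`:
`(x₁ ∧ ⋯ ∧ x_b) ∨ G`) of `B × Q` with the layered weight `ν(b,s) = w_b ν'(s)` carries an exact flow certificate — the FLAT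
COMPOSITE (top fibre cap-tight, lower fibres = the inner certificate scaled by `q = w(B ∖ t)`, receivers `(b,s)`, `s ∉ G`, fed
vertically by `(t,s)` with `p w_b ν'(s)` and by the inner flows).  (R0), (F0), (F≤), (cap), (K) are bookkeeping
(`…SahiE3BlockLayers`); the pair inequality is `…SahiE3BlockPair.block_pair` applied to the section profiles.  The statement is
first proved for normalised weights (`cert_block_or_step_norm`) and then rescaled (`cert_scale`).  This contains
`cert_or_step` (`B = Bool`) and `cert_dimer_or_step` (`B = Bool²`) and gives, by induction over blocks, the certificate of every
read-once DNF `⋁ᵢ ⋀_{j ∈ Bᵢ} x_j` (next files).  HOME prim-l12-p4/FROM-prim-l12-p4-gen15-BLOCK-OR-STEP.md.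
-/

namespace Summit.CriticalPhenomena.PercolationContinuityZ3.Theorems.SahiE3BlockOrStep

open Finset SahiE3BlockLayers SahiE3BlockPair SahiE3ProductSections
open scoped BigOperators

/-! ### Rescaling a certificate -/

/-- **Flow certificates rescale**: if `(R, Fl)` is an exact flow certificate for the weight `ν₀` and `ν = c ν₀` with `c ≥ 0`, then
`(c³ R, c³ Fl)` is one for `ν` (all conditions are cubic in the weight). [folklore] -/
theorem cert_scale {P : Type*} [Fintype P] [DecidableEq P] [PartialOrder P] {ν₀ ν : P → ℝ} {c : ℝ} (hc : 0 ≤ c)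
    (hν : ∀ x, ν x = c * ν₀ x) {U : Finset P} {R : P → ℝ} {Fl : P → P → ℝ}
    (hR0 : ∀ t ∈ U, 0 ≤ R t) (hF0 : ∀ t s, 0 ≤ Fl t s) (hFle : ∀ t s, Fl t s ≠ 0 → s ≤ t)
    (hcap : ∀ t ∈ U, R t + ∑ s ∈ Uᶜ, Fl t s ≤ (∑ r, ν₀ r) * ((∑ r, ν₀ r) + ∑ r ∈ Uᶜ, ν₀ r) * ν₀ t)
    (hK : ∀ s ∈ Uᶜ, ∑ t ∈ U, Fl t s = (∑ r, ν₀ r) * (∑ r ∈ U, ν₀ r) * ν₀ s)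
    (hpair : ∀ S S' : Finset P, IsUpperSet (S : Set P) → IsUpperSet (S' : Set P) →
      (∑ r, ν₀ r) * ((∑ t ∈ S, ν₀ t) * (∑ t ∈ S' ∩ U, ν₀ t) + (∑ t ∈ S', ν₀ t) * (∑ t ∈ S ∩ U, ν₀ t))
          - (∑ r ∈ U, ν₀ r) * (∑ t ∈ S, ν₀ t) * (∑ t ∈ S', ν₀ t) ≤ ∑ t ∈ (S ∩ S') ∩ U, R t) :
    ∃ (R' : P → ℝ) (Fl' : P → P → ℝ),
      (∀ t ∈ U, 0 ≤ R' t) ∧ (∀ t s, 0 ≤ Fl' t s) ∧ (∀ t s, Fl' t s ≠ 0 → s ≤ t) ∧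
      (∀ t ∈ U, R' t + ∑ s ∈ Uᶜ, Fl' t s ≤ (∑ r, ν r) * ((∑ r, ν r) + ∑ r ∈ Uᶜ, ν r) * ν t) ∧
      (∀ s ∈ Uᶜ, ∑ t ∈ U, Fl' t s = (∑ r, ν r) * (∑ r ∈ U, ν r) * ν s) ∧
      (∀ S S' : Finset P, IsUpperSet (S : Set P) → IsUpperSet (S' : Set P) →
        (∑ r, ν r) * ((∑ t ∈ S, ν t) * (∑ t ∈ S' ∩ U, ν t) + (∑ t ∈ S', ν t) * (∑ t ∈ S ∩ U, ν t))
            - (∑ r ∈ U, ν r) * (∑ t ∈ S, ν t) * (∑ t ∈ S', ν t) ≤ ∑ t ∈ (S ∩ S') ∩ U, R' t) := by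
  have hsum : ∀ X : Finset P, ∑ x ∈ X, ν x = c * ∑ x ∈ X, ν₀ x := fun X => by
    rw [Finset.mul_sum]; exact Finset.sum_congr rfl fun x _ => hν x
  have hc3 : 0 ≤ c ^ 3 := by positivity
  refine ⟨fun x => c ^ 3 * R x, fun x y => c ^ 3 * Fl x y, ?_, ?_, ?_, ?_, ?_, ?_⟩
  · intro t ht; exact mul_nonneg hc3 (hR0 t ht)
  · intro t s; exact mul_nonneg hc3 (hF0 t s)
  · intro t s h
    dsimp only at h
    exact hFle t s (fun h0 => h (by rw [h0, mul_zero]))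
  · intro t ht
    rw [← Finset.mul_sum, ← mul_add, hsum, hsum, hν]
    have := mul_le_mul_of_nonneg_left (hcap t ht) hc3
    nlinarith [this]
  · intro s hs
    rw [← Finset.mul_sum, hK s hs, hsum, hsum, hν]; ring
  · intro S S' hS hS'
    rw [← Finset.mul_sum, hsum, hsum, hsum, hsum, hsum, hsum]
    have := mul_le_mul_of_nonneg_left (hpair S S' hS hS') hc3
    nlinarith [this]

variable {B Q : Type*} [Fintype B] [DecidableEq B] [PartialOrder B] [Fintype Q] [DecidableEq Q] [PartialOrder Q]

set_option maxHeartbeats 1600000 in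
/-- **The principal block OR-step, normalised weights** (`Σ w = 1`, `Σ ν' = 1`): see `cert_block_or_step`. [this work] -/
theorem cert_block_or_step_norm {t : B} (ht : ∀ b, b ≤ t) {w : B → ℝ} (hw : ∀ b, 0 ≤ w b) (hW : ∑ b, w b = 1)
    (hHB : ∀ I J : Finset B, IsUpperSet (I : Set B) → IsUpperSet (J : Set B) →
      (∑ b ∈ I, w b) * (∑ b ∈ J, w b) ≤ (∑ b, w b) * ∑ b ∈ I ∩ J, w b)
    {ν' : Q → ℝ} (hν' : ∀ s, 0 ≤ ν' s) (hZ : ∑ s, ν' s = 1)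
    (hH : ∀ S S' : Finset Q, IsUpperSet (S : Set Q) → IsUpperSet (S' : Set Q) →
      (∑ t ∈ S, ν' t) * (∑ t ∈ S', ν' t) ≤ (∑ t, ν' t) * ∑ t ∈ S ∩ S', ν' t)
    (G : Finset Q) (hG : IsUpperSet (G : Set Q)) (R' : Q → ℝ) (Fl' : Q → Q → ℝ)
    (hR'0 : ∀ s ∈ G, 0 ≤ R' s) (hF'0 : ∀ r s, 0 ≤ Fl' r s) (hF'le : ∀ r s, Fl' r s ≠ 0 → s ≤ r)
    (hcap' : ∀ s ∈ G, R' s + ∑ s' ∈ Gᶜ, Fl' s s' ≤ (∑ r, ν' r) * ((∑ r, ν' r) + ∑ r ∈ Gᶜ, ν' r) * ν' s)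
    (hK' : ∀ s ∈ Gᶜ, ∑ r ∈ G, Fl' r s = (∑ r, ν' r) * (∑ r ∈ G, ν' r) * ν' s)
    (hpair' : ∀ S S' : Finset Q, IsUpperSet (S : Set Q) → IsUpperSet (S' : Set Q) →
      (∑ r, ν' r) * ((∑ s ∈ S, ν' s) * (∑ s ∈ S' ∩ G, ν' s) + (∑ s ∈ S', ν' s) * (∑ s ∈ S ∩ G, ν' s))
          - (∑ r ∈ G, ν' r) * (∑ s ∈ S, ν' s) * (∑ s ∈ S', ν' s) ≤ ∑ s ∈ (S ∩ S') ∩ G, R' s)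
    (ν : B × Q → ℝ) (hν : ∀ b s, ν (b, s) = w b * ν' s)
    (U : Finset (B × Q)) (hU : ∀ x, x ∈ U ↔ (x.1 = t ∨ x.2 ∈ G)) :
    ∃ (R : B × Q → ℝ) (Fl : (B × Q) → (B × Q) → ℝ),
      (∀ x ∈ U, 0 ≤ R x) ∧ (∀ x y, 0 ≤ Fl x y) ∧ (∀ x y, Fl x y ≠ 0 → y ≤ x) ∧
      (∀ x ∈ U, R x + ∑ y ∈ Uᶜ, Fl x y ≤ (∑ r, ν r) * ((∑ r, ν r) + ∑ r ∈ Uᶜ, ν r) * ν x) ∧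
      (∀ y ∈ Uᶜ, ∑ x ∈ U, Fl x y = (∑ r, ν r) * (∑ r ∈ U, ν r) * ν y) ∧
      (∀ S S' : Finset (B × Q), IsUpperSet (S : Set (B × Q)) → IsUpperSet (S' : Set (B × Q)) →
        (∑ r, ν r) * ((∑ x ∈ S, ν x) * (∑ x ∈ S' ∩ U, ν x) + (∑ x ∈ S', ν x) * (∑ x ∈ S ∩ U, ν x))
            - (∑ r ∈ U, ν r) * (∑ x ∈ S, ν x) * (∑ x ∈ S', ν x) ≤ ∑ x ∈ (S ∩ S') ∩ U, R x) := by
  -- normalised constants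
  rw [hZ] at hH hcap' hK' hpair'
  set p : ℝ := w t with hpdef
  set q : ℝ := ∑ b ∈ univ.erase t, w b with hqdef
  have hp0 : 0 ≤ p := hw t
  have hq0 : 0 ≤ q := Finset.sum_nonneg fun b _ => hw b
  have hpq : p + q = 1 := by rw [hpdef, hqdef, Finset.add_sum_erase univ w (Finset.mem_univ t), hW]
  obtain ⟨u', hu'⟩ : ∃ x, ∑ s ∈ G, ν' s = x := ⟨_, rfl⟩
  have hu'0 : 0 ≤ u' := hu' ▸ Finset.sum_nonneg fun s _ => hν' s
  have hGc : ∑ r ∈ Gᶜ, ν' r = 1 - u' := by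
    have := Finset.sum_add_sum_compl G ν'; rw [hZ, hu'] at this; linarith
  have hu'1 : u' ≤ 1 := by have := Finset.sum_nonneg (s := Gᶜ) fun s _ => hν' s; rw [hGc] at this; linarith
  rw [hGc] at hcap'
  rw [hu'] at hK' hpair'
  -- masses of `univ`, `U`, `Uᶜ`
  have eZ : ∑ x, ν x = 1 := by rw [mass_univ w ν' ν hν, hW, hZ, one_mul]
  have eU : ∑ x ∈ U, ν x = p + q * u' := by rw [mass_slot w ν' ν hν t G U hU, hZ, hu', mul_one]
  have eUc : ∑ x ∈ Uᶜ, ν x = q * (1 - u') := by rw [mass_slot_compl w ν' ν hν t G U hU, hGc]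
  have memU : ∀ (b : B) (s : Q), ((b, s) ∈ U) ↔ (b = t ∨ s ∈ G) := fun b s => hU (b, s)
  -- the certificate
  refine ⟨fun x => if x.1 = t then p * ν' x.2 * ((1 + q * (1 - u')) - (if x.2 ∈ G then 0 else q))
      else w x.1 * (p * ν' x.2 + q * R' x.2),
    fun x y => if y.1 = t then 0 else if x.1 = t then (if x.2 = y.2 then p * w y.1 * ν' y.2 else 0)
      else (if x.1 = y.1 then q * w y.1 * Fl' x.2 y.2 else 0), ?_, ?_, ?_, ?_, ?_, ?_⟩
  · -- (R0)
    rintro ⟨b, s⟩ hx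
    by_cases hb : b = t
    · simp only [hb, ↓reduceIte]
      have h1 : 0 ≤ (1 + q * (1 - u')) - (if s ∈ G then 0 else q) := by
        split_ifs <;> nlinarith [mul_nonneg hq0 (sub_nonneg.2 hu'1)]
      exact mul_nonneg (mul_nonneg hp0 (hν' s)) h1
    · have hs : s ∈ G := by have := (memU b s).1 hx; tauto
      simp only [hb, ↓reduceIte]
      exact mul_nonneg (hw b) (add_nonneg (mul_nonneg hp0 (hν' s)) (mul_nonneg hq0 (hR'0 s hs)))
  · -- (F0)
    rintro ⟨b, s⟩ ⟨b', s'⟩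
    dsimp only
    have := hF'0 s s'; have := hν' s'; have := hw b'
    split_ifs <;> positivity
  · -- (F≤)
    rintro ⟨b, s⟩ ⟨b', s'⟩ h
    dsimp only at h
    by_cases hb' : b' = t
    · exact absurd (by simp [hb']) h
    · simp only [hb', ↓reduceIte] at h
      by_cases hb : b = t
      · simp only [hb, ↓reduceIte, ne_eq, ite_eq_right_iff, Classical.not_imp] at h
        obtain ⟨hss', -⟩ := h
        subst hss'
        exact Prod.mk_le_mk.2 ⟨hb ▸ ht b', le_rfl⟩
      · simp only [hb, ↓reduceIte, ne_eq, ite_eq_right_iff, Classical.not_imp] at h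
        obtain ⟨hbb', hne⟩ := h
        subst hbb'
        exact Prod.mk_le_mk.2 ⟨le_rfl, hF'le s s' (fun h0 => hne (by rw [h0, mul_zero]))⟩
  · -- (cap)
    rintro ⟨b, s⟩ hx
    rw [eZ, eUc, one_mul, hν]
    by_cases hb : b = t
    · subst hb
      rw [flow_out_top w ν' Fl' b G U hU p q s, ← hqdef]
      simp only [↓reduceIte]
      have hν0 := hν' s
      split_ifs <;> nlinarith [hν0]
    · have hs : s ∈ G := by have := (memU b s).1 hx; tauto
      rw [flow_out_low w ν' Fl' t G U hU p q hb s]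
      simp only [hb, ↓reduceIte]
      have hc := hcap' s hs
      have h1 : p * ν' s + q * R' s + q * ∑ s' ∈ Gᶜ, Fl' s s' ≤ p * ν' s + q * ((1 + (1 - u')) * ν' s) := by
        nlinarith [mul_le_mul_of_nonneg_left hc hq0]
      have h2 := mul_le_mul_of_nonneg_left h1 (hw b)
      have e : w b * (p * ν' s + q * ((1 + (1 - u')) * ν' s)) = (1 + q * (1 - u')) * (w b * ν' s) := by
        have : p = 1 - q := by linarith
        rw [this]; ring
      calc w b * (p * ν' s + q * R' s) + q * w b * ∑ s' ∈ Gᶜ, Fl' s s'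
          = w b * (p * ν' s + q * R' s + q * ∑ s' ∈ Gᶜ, Fl' s s') := by ring
        _ ≤ w b * (p * ν' s + q * ((1 + (1 - u')) * ν' s)) := h2
        _ = (1 + q * (1 - u')) * (w b * ν' s) := e
  · -- (K) with equality
    rintro ⟨b, s⟩ hy
    obtain ⟨hb, hs⟩ : ¬ b = t ∧ s ∉ G := by simpa [memU] using hy
    rw [flow_in w ν' Fl' t G U hU p q hb s, hK' s (by simpa using hs), eZ, eU, hν]
    ring
  · -- (pair)
    intro S S' hS hS'
    rw [eZ, eU, one_mul, mass_profile w ν' ν hν t S, mass_profile w ν' ν hν t S',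
      mass_inter_slot_profile w ν' ν hν t G U hU S, mass_inter_slot_profile w ν' ν hν t G U hU S',
      retained_profile w ν' R' t G U hU p q (1 + q * (1 - u')) q S S']
    -- the profiles
    have ha : ∀ s, (fun s => if (t, s) ∈ S then (1:ℝ) else 0) s = 0 ∨ (fun s => if (t, s) ∈ S then (1:ℝ) else 0) s = 1 :=
      fun s => by dsimp only; split_ifs <;> simp
    have ha' : ∀ s, (fun s => if (t, s) ∈ S' then (1:ℝ) else 0) s = 0 ∨ (fun s => if (t, s) ∈ S' then (1:ℝ) else 0) s = 1 :=
      fun s => by dsimp only; split_ifs <;> simp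
    have hHn : ∀ V W : Finset Q, IsUpperSet (V : Set Q) → IsUpperSet (W : Set Q) →
        (∑ s ∈ V, ν' s) * (∑ s ∈ W, ν' s) ≤ ∑ s ∈ V ∩ W, ν' s := fun V W hV hW => by
      have := hH V W hV hW; rwa [one_mul] at this
    have hcapn : ∀ s ∈ G, R' s ≤ (1 + ∑ r ∈ Gᶜ, ν' r) * ν' s := by
      intro s hs
      rw [hGc]
      have h1 := hcap' s hs
      have h2 : 0 ≤ ∑ s' ∈ Gᶜ, Fl' s s' := Finset.sum_nonneg fun s' _ => hF'0 s s'
      linarith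
    have hpairn : ∀ V W : Finset Q, IsUpperSet (V : Set Q) → IsUpperSet (W : Set Q) →
        ((∑ s ∈ V, ν' s) * (∑ s ∈ W ∩ G, ν' s) + (∑ s ∈ W, ν' s) * (∑ s ∈ V ∩ G, ν' s))
          - (∑ s ∈ G, ν' s) * (∑ s ∈ V, ν' s) * (∑ s ∈ W, ν' s) ≤ ∑ s ∈ (V ∩ W) ∩ G, R' s := fun V W hV hW => by
      have := hpair' V W hV hW; rw [one_mul] at this; rw [hu']; exact this
    have key := block_pair (R' := R') hν' hZ hHn hG hR'0 hcapn hpairn hp0 hq0 hpq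
      (a := fun s => if (t, s) ∈ S then (1:ℝ) else 0) (a' := fun s => if (t, s) ∈ S' then (1:ℝ) else 0)
      (f := fun s => ∑ b ∈ univ.erase t, (if (b, s) ∈ S then w b else 0))
      (f' := fun s => ∑ b ∈ univ.erase t, (if (b, s) ∈ S' then w b else 0))
      (h := fun s => ∑ b ∈ univ.erase t, (if (b, s) ∈ S ∧ (b, s) ∈ S' then w b else 0))
      ha ha' (profile_a_mono hS t) (profile_a_mono hS' t) (profile_f_mono hw hS t) (profile_f_mono hw hS' t)
      (fun s => (profile_f_bounds hw hS ht s).1) (fun s => (profile_f_bounds hw hS ht s).2)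
      (fun s => (profile_f_bounds hw hS' ht s).1) (fun s => (profile_f_bounds hw hS' ht s).2)
      (fun s => (profile_h_bounds hw S S' t s).1) (fun s => (profile_h_bounds hw S S' t s).2.1)
      (fun s => (profile_h_bounds hw S S' t s).2.2)
      (fun s => by have := harrisB_profile hHB hS hS' t s; rwa [hW, one_mul] at this)
    rw [hu'] at key
    -- the retained mass in the form of `block_pair`
    have eTop : ∑ s, (if (t, s) ∈ S then (1:ℝ) else 0) * (if (t, s) ∈ S' then (1:ℝ) else 0) *
          (p * ν' s * ((1 + q * (1 - u')) - (if s ∈ G then 0 else q))) =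
        p * (1 + q * (1 - u')) * ∑ s ∈ G, ν' s * ((if (t, s) ∈ S then (1:ℝ) else 0) * (if (t, s) ∈ S' then (1:ℝ) else 0))
        + p * (p + q * (1 - u')) * (∑ s, ν' s * ((if (t, s) ∈ S then (1:ℝ) else 0) * (if (t, s) ∈ S' then (1:ℝ) else 0))
          - ∑ s ∈ G, ν' s * ((if (t, s) ∈ S then (1:ℝ) else 0) * (if (t, s) ∈ S' then (1:ℝ) else 0))) := by
      have hp' : p = 1 - q := by linarith
      rw [← Finset.sum_filter_add_sum_filter_not univ (fun s => s ∈ G), Finset.filter_mem_eq_inter, Finset.univ_inter]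
      have e1 : ∑ s ∈ G, (if (t, s) ∈ S then (1:ℝ) else 0) * (if (t, s) ∈ S' then (1:ℝ) else 0) *
          (p * ν' s * ((1 + q * (1 - u')) - (if s ∈ G then 0 else q))) =
          p * (1 + q * (1 - u')) * ∑ s ∈ G, ν' s * ((if (t, s) ∈ S then (1:ℝ) else 0) * (if (t, s) ∈ S' then (1:ℝ) else 0)) := by
        rw [Finset.mul_sum]; exact Finset.sum_congr rfl fun s hs => by rw [if_pos hs]; ring
      have e2 : ∑ s ∈ univ.filter (fun s => ¬ s ∈ G), (if (t, s) ∈ S then (1:ℝ) else 0) * (if (t, s) ∈ S' then (1:ℝ) else 0) *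
          (p * ν' s * ((1 + q * (1 - u')) - (if s ∈ G then 0 else q))) =
          p * (p + q * (1 - u')) * ∑ s ∈ univ.filter (fun s => ¬ s ∈ G),
            ν' s * ((if (t, s) ∈ S then (1:ℝ) else 0) * (if (t, s) ∈ S' then (1:ℝ) else 0)) := by
        rw [Finset.mul_sum]
        refine Finset.sum_congr rfl fun s hs => ?_
        have hs' : s ∉ G := by simpa using hs
        rw [if_neg hs', hp']; ring
      have e3 : ∑ s ∈ univ.filter (fun s => ¬ s ∈ G), ν' s * ((if (t, s) ∈ S then (1:ℝ) else 0) * (if (t, s) ∈ S' then (1:ℝ) else 0)) =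
          ∑ s, ν' s * ((if (t, s) ∈ S then (1:ℝ) else 0) * (if (t, s) ∈ S' then (1:ℝ) else 0))
          - ∑ s ∈ G, ν' s * ((if (t, s) ∈ S then (1:ℝ) else 0) * (if (t, s) ∈ S' then (1:ℝ) else 0)) := by
        rw [← Finset.sum_filter_add_sum_filter_not univ (fun s => s ∈ G)
          (fun s => ν' s * ((if (t, s) ∈ S then (1:ℝ) else 0) * (if (t, s) ∈ S' then (1:ℝ) else 0))),
          Finset.filter_mem_eq_inter, Finset.univ_inter]
        ring
      rw [e1, e2, e3]
    have eLow : ∑ s ∈ G, (∑ b ∈ univ.erase t, (if (b, s) ∈ S ∧ (b, s) ∈ S' then w b else 0)) * (p * ν' s + q * R' s) =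
        p * ∑ s ∈ G, ν' s * ∑ b ∈ univ.erase t, (if (b, s) ∈ S ∧ (b, s) ∈ S' then w b else 0)
        + q * ∑ s ∈ G, R' s * ∑ b ∈ univ.erase t, (if (b, s) ∈ S ∧ (b, s) ∈ S' then w b else 0) := by
      rw [Finset.mul_sum, Finset.mul_sum, ← Finset.sum_add_distrib]
      exact Finset.sum_congr rfl fun s _ => by ring
    rw [eTop, eLow]
    linarith [key]

/-! ### General weights -/

omit [DecidableEq B] in
/-- Harris' inequality is homogeneous in the weight. [folklore] -/
theorem harris_smul {w : B → ℝ} {c : ℝ} (hc : 0 ≤ c) [DecidableEq B]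
    (hHB : ∀ I J : Finset B, IsUpperSet (I : Set B) → IsUpperSet (J : Set B) →
      (∑ b ∈ I, w b) * (∑ b ∈ J, w b) ≤ (∑ b, w b) * ∑ b ∈ I ∩ J, w b)
    (I J : Finset B) (hI : IsUpperSet (I : Set B)) (hJ : IsUpperSet (J : Set B)) :
    (∑ b ∈ I, c * w b) * (∑ b ∈ J, c * w b) ≤ (∑ b, c * w b) * ∑ b ∈ I ∩ J, c * w b := by
  rw [← Finset.mul_sum, ← Finset.mul_sum, ← Finset.mul_sum, ← Finset.mul_sum]
  have := mul_le_mul_of_nonneg_left (hHB I J hI hJ) (mul_nonneg hc hc)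
  nlinarith [this]

/-- The trivial certificate for the zero weight. [folklore] -/
theorem cert_zero {P : Type*} [Fintype P] [DecidableEq P] [PartialOrder P] {ν : P → ℝ} (hν : ∀ x, ν x = 0) (U : Finset P) :
    ∃ (R : P → ℝ) (Fl : P → P → ℝ),
      (∀ t ∈ U, 0 ≤ R t) ∧ (∀ t s, 0 ≤ Fl t s) ∧ (∀ t s, Fl t s ≠ 0 → s ≤ t) ∧
      (∀ t ∈ U, R t + ∑ s ∈ Uᶜ, Fl t s ≤ (∑ r, ν r) * ((∑ r, ν r) + ∑ r ∈ Uᶜ, ν r) * ν t) ∧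
      (∀ s ∈ Uᶜ, ∑ t ∈ U, Fl t s = (∑ r, ν r) * (∑ r ∈ U, ν r) * ν s) ∧
      (∀ S S' : Finset P, IsUpperSet (S : Set P) → IsUpperSet (S' : Set P) →
        (∑ r, ν r) * ((∑ t ∈ S, ν t) * (∑ t ∈ S' ∩ U, ν t) + (∑ t ∈ S', ν t) * (∑ t ∈ S ∩ U, ν t))
            - (∑ r ∈ U, ν r) * (∑ t ∈ S, ν t) * (∑ t ∈ S', ν t) ≤ ∑ t ∈ (S ∩ S') ∩ U, R t) := by
  refine ⟨fun _ => 0, fun _ _ => 0, fun _ _ => le_rfl, fun _ _ => le_rfl, fun _ _ h => absurd rfl h, ?_, ?_, ?_⟩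
  · intro t _; simp [hν]
  · intro s _; simp [hν]
  · intro S S' _ _; simp [hν]

/-- **The principal block OR-step** `(x_B = ⊤) ∨ G` for arbitrary (unnormalised) nonnegative weights: see the module docstring.
[this work] -/
theorem cert_block_or_step {t : B} (ht : ∀ b, b ≤ t) {w : B → ℝ} (hw : ∀ b, 0 ≤ w b)
    (hHB : ∀ I J : Finset B, IsUpperSet (I : Set B) → IsUpperSet (J : Set B) →
      (∑ b ∈ I, w b) * (∑ b ∈ J, w b) ≤ (∑ b, w b) * ∑ b ∈ I ∩ J, w b)
    {ν' : Q → ℝ} (hν' : ∀ s, 0 ≤ ν' s)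
    (hH : ∀ S S' : Finset Q, IsUpperSet (S : Set Q) → IsUpperSet (S' : Set Q) →
      (∑ t ∈ S, ν' t) * (∑ t ∈ S', ν' t) ≤ (∑ t, ν' t) * ∑ t ∈ S ∩ S', ν' t)
    (G : Finset Q) (hG : IsUpperSet (G : Set Q)) (R' : Q → ℝ) (Fl' : Q → Q → ℝ)
    (hR'0 : ∀ s ∈ G, 0 ≤ R' s) (hF'0 : ∀ r s, 0 ≤ Fl' r s) (hF'le : ∀ r s, Fl' r s ≠ 0 → s ≤ r)
    (hcap' : ∀ s ∈ G, R' s + ∑ s' ∈ Gᶜ, Fl' s s' ≤ (∑ r, ν' r) * ((∑ r, ν' r) + ∑ r ∈ Gᶜ, ν' r) * ν' s)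
    (hK' : ∀ s ∈ Gᶜ, ∑ r ∈ G, Fl' r s = (∑ r, ν' r) * (∑ r ∈ G, ν' r) * ν' s)
    (hpair' : ∀ S S' : Finset Q, IsUpperSet (S : Set Q) → IsUpperSet (S' : Set Q) →
      (∑ r, ν' r) * ((∑ s ∈ S, ν' s) * (∑ s ∈ S' ∩ G, ν' s) + (∑ s ∈ S', ν' s) * (∑ s ∈ S ∩ G, ν' s))
          - (∑ r ∈ G, ν' r) * (∑ s ∈ S, ν' s) * (∑ s ∈ S', ν' s) ≤ ∑ s ∈ (S ∩ S') ∩ G, R' s)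
    (ν : B × Q → ℝ) (hν : ∀ b s, ν (b, s) = w b * ν' s)
    (U : Finset (B × Q)) (hU : ∀ x, x ∈ U ↔ (x.1 = t ∨ x.2 ∈ G)) :
    ∃ (R : B × Q → ℝ) (Fl : (B × Q) → (B × Q) → ℝ),
      (∀ x ∈ U, 0 ≤ R x) ∧ (∀ x y, 0 ≤ Fl x y) ∧ (∀ x y, Fl x y ≠ 0 → y ≤ x) ∧
      (∀ x ∈ U, R x + ∑ y ∈ Uᶜ, Fl x y ≤ (∑ r, ν r) * ((∑ r, ν r) + ∑ r ∈ Uᶜ, ν r) * ν x) ∧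
      (∀ y ∈ Uᶜ, ∑ x ∈ U, Fl x y = (∑ r, ν r) * (∑ r ∈ U, ν r) * ν y) ∧
      (∀ S S' : Finset (B × Q), IsUpperSet (S : Set (B × Q)) → IsUpperSet (S' : Set (B × Q)) →
        (∑ r, ν r) * ((∑ x ∈ S, ν x) * (∑ x ∈ S' ∩ U, ν x) + (∑ x ∈ S', ν x) * (∑ x ∈ S ∩ U, ν x))
            - (∑ r ∈ U, ν r) * (∑ x ∈ S, ν x) * (∑ x ∈ S', ν x) ≤ ∑ x ∈ (S ∩ S') ∩ U, R x) := by
  obtain ⟨W, hWdef⟩ : ∃ x, ∑ b, w b = x := ⟨_, rfl⟩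
  obtain ⟨Z, hZdef⟩ : ∃ x, ∑ s, ν' s = x := ⟨_, rfl⟩
  have hW0le : 0 ≤ W := hWdef ▸ Finset.sum_nonneg fun b _ => hw b
  have hZ0le : 0 ≤ Z := hZdef ▸ Finset.sum_nonneg fun s _ => hν' s
  -- degenerate weights: the zero certificate
  by_cases hW0 : W = 0
  · have hw0 : ∀ b, w b = 0 := fun b =>
      (Finset.sum_eq_zero_iff_of_nonneg (fun b _ => hw b)).1 (hWdef.trans hW0) b (Finset.mem_univ b)
    exact cert_zero (fun x => by obtain ⟨b, s⟩ := x; rw [hν, hw0, zero_mul]) U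
  by_cases hZ0 : Z = 0
  · have hν0 : ∀ s, ν' s = 0 := fun s =>
      (Finset.sum_eq_zero_iff_of_nonneg (fun s _ => hν' s)).1 (hZdef.trans hZ0) s (Finset.mem_univ s)
    exact cert_zero (fun x => by obtain ⟨b, s⟩ := x; rw [hν, hν0, mul_zero]) U
  have hWpos : 0 < W := lt_of_le_of_ne hW0le (Ne.symm hW0)
  have hZpos : 0 < Z := lt_of_le_of_ne hZ0le (Ne.symm hZ0)
  -- normalised data
  have hw₁ : ∀ b, 0 ≤ W⁻¹ * w b := fun b => mul_nonneg (inv_nonneg.2 hW0le) (hw b)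
  have hW₁ : ∑ b, W⁻¹ * w b = 1 := by rw [← Finset.mul_sum, hWdef, inv_mul_cancel₀ hW0]
  have hHB₁ := harris_smul (inv_nonneg.2 hW0le) hHB
  have hν₁ : ∀ s, 0 ≤ Z⁻¹ * ν' s := fun s => mul_nonneg (inv_nonneg.2 hZ0le) (hν' s)
  have hZ₁ : ∑ s, Z⁻¹ * ν' s = 1 := by rw [← Finset.mul_sum, hZdef, inv_mul_cancel₀ hZ0]
  have hH₁ := harris_smul (inv_nonneg.2 hZ0le) hH
  obtain ⟨R₁, Fl₁, c1, c2, c3, c4, c5, c6⟩ := cert_scale (ν₀ := ν') (ν := fun s => Z⁻¹ * ν' s) (inv_nonneg.2 hZ0le)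
    (fun _ => rfl) hR'0 hF'0 hF'le hcap' hK' hpair'
  obtain ⟨R₀, Fl₀, d1, d2, d3, d4, d5, d6⟩ := cert_block_or_step_norm ht hw₁ hW₁ hHB₁ hν₁ hZ₁ hH₁ G hG R₁ Fl₁
    c1 c2 c3 c4 c5 c6 (fun x => (W⁻¹ * w x.1) * (Z⁻¹ * ν' x.2)) (fun _ _ => rfl) U hU
  have hνe : ∀ x : B × Q, ν x = (W * Z) * ((fun x : B × Q => (W⁻¹ * w x.1) * (Z⁻¹ * ν' x.2)) x) := by
    rintro ⟨b, s⟩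
    dsimp only
    rw [hν, show W * Z * (W⁻¹ * w b * (Z⁻¹ * ν' s)) = (W * W⁻¹) * (Z * Z⁻¹) * (w b * ν' s) by ring,
      mul_inv_cancel₀ hW0, mul_inv_cancel₀ hZ0, one_mul, one_mul]
  exact cert_scale (mul_nonneg hW0le hZ0le) hνe d1 d2 d3 d4 d5 d6

end Summit.CriticalPhenomena.PercolationContinuityZ3.Theorems.SahiE3BlockOrStep
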